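import Summits.KontsevichZagierPeriods.KontsevichZagierPeriods.Theorems.LinRedNormalFormArrangementNormalFormSeparateTaylor
import Summits.KontsevichZagierPeriods.KontsevichZagierPeriods.Theorems.LinRedNormalFormArrangementNormalFormSeparateEngine

/-!
# The vertical shear chart, real Taylor data and the wall factorisation

(Line `janus-bands`, crux `ArrangementNormalForm`, stub `stub_separateTwoZero` — separation in a
good rational direction for PLANAR arrangement representations without fibres; part `Chart`.)

The measure-preserving shear chart `(u, λ) ↦ (x₀ + u, sl (x₀ + u) + ic + λ)` of the base plane
(`chart`, `measurePreserving_chart`, registered as `separateTwoZero_chart`), in which the pole line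
`y = sl x + ic` becomes `λ = 0`; real Taylor expansions `q(x₀ + u) = ∑ cₘ u^m` of one-variable
rational polynomials (`exists_real_taylor`, `exists_coeff_data`); the factorisation of the wall
block `∏ (κⱼ x + μⱼ)^{eⱼ} = u^E W₁(u)` at an abscissa (`wall_factor`); and the coordinate
dictionary of `Fin (1 + 1 + 0) → ℝ` with the engine's `affB`/`fib`.
-/

noncomputable section

open Set MeasureTheory Filter Topology
open scoped ENNReal

namespace Summit.KontsevichZagierPeriods.ArrangementNormalForm.JanusBands

open Literature.NumberTheory.Transcendental

namespace SepTwoZero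

/-- The shear chart at abscissa `x₀` along the line `y = sl·x + ic`:
`(u, λ) ↦ (x₀ + u, sl (x₀ + u) + ic + λ)`. -/
def chartHomeo (x₀ sl ic : ℝ) : ℝ × ℝ ≃ₜ ℝ × ℝ where
  toFun w := (x₀ + w.1, w.2 + (sl * (x₀ + w.1) + ic))
  invFun p := (p.1 - x₀, p.2 - (sl * p.1 + ic))
  left_inv w := by ext <;> simp
  right_inv p := by ext <;> simp
  continuous_toFun := by fun_prop
  continuous_invFun := by fun_prop

/-- The shear chart as a measurable equivalence onto `Fin 2 → ℝ`. -/
def chart (x₀ sl ic : ℝ) : ℝ × ℝ ≃ᵐ (Fin 2 → ℝ) :=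
  (chartHomeo x₀ sl ic).toMeasurableEquiv.trans MeasurableEquiv.finTwoArrow.symm

/-- The shear chart in coordinates. -/
theorem chart_apply (x₀ sl ic : ℝ) (w : ℝ × ℝ) :
    chart x₀ sl ic w = ![x₀ + w.1, w.2 + (sl * (x₀ + w.1) + ic)] := by
  ext i
  simp only [chart, MeasurableEquiv.trans_apply, Homeomorph.toMeasurableEquiv_coe,
    MeasurableEquiv.finTwoArrow_symm_apply]
  fin_cases i <;> rfl

/-- First coordinate of the shear chart. -/
@[simp] theorem chart_apply_zero (x₀ sl ic : ℝ) (w : ℝ × ℝ) : chart x₀ sl ic w 0 = x₀ + w.1 := by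
  rw [chart_apply]; rfl

/-- Second coordinate of the shear chart. -/
@[simp] theorem chart_apply_one (x₀ sl ic : ℝ) (w : ℝ × ℝ) :
    chart x₀ sl ic w 1 = w.2 + (sl * (x₀ + w.1) + ic) := by
  rw [chart_apply]; rfl

/-- The inverse shear chart in coordinates. -/
theorem chart_symm_apply (x₀ sl ic : ℝ) (z : Fin 2 → ℝ) :
    (chart x₀ sl ic).symm z = (z 0 - x₀, z 1 - (sl * z 0 + ic)) := by
  simp [chart, MeasurableEquiv.finTwoArrow_apply, chartHomeo]

/-- The shear chart preserves Lebesgue measure. -/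
theorem measurePreserving_chart (x₀ sl ic : ℝ) :
    MeasurePreserving (chart x₀ sl ic) volume volume := by
  have h1 : MeasurePreserving (chartHomeo x₀ sl ic) volume volume := by
    have := (measurePreserving_add_left (volume : Measure ℝ) x₀).skew_product
      (g := fun u l => l + (sl * (x₀ + u) + ic)) (by fun_prop)
      (Eventually.of_forall fun u => (measurePreserving_add_right (volume : Measure ℝ)
        (sl * (x₀ + u) + ic)).map_eq)
    rw [Measure.volume_eq_prod]
    exact this
  exact h1.trans (volume_preserving_finTwoArrow ℝ).symm

/-- `q(x₀ + u)` is a real polynomial in `u`. -/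
theorem exists_real_taylor (q : MvPolynomial (Fin 1) ℚ) (x₀ : ℝ) :
    ∃ (K : ℕ) (c : ℕ → ℝ), ∀ u : ℝ,
      MvPolynomial.aeval (fun _ : Fin 1 => x₀ + u) q = ∑ m ∈ Finset.range K, c m * u ^ m := by
  set P : Polynomial ℝ := MvPolynomial.aeval (fun _ : Fin 1 => (Polynomial.X : Polynomial ℝ)) q
    with hP
  have hev : ∀ t : ℝ, P.eval t = MvPolynomial.aeval (fun _ : Fin 1 => t) q := by
    intro t
    have h := MvPolynomial.comp_aeval_apply (fun _ : Fin 1 => (Polynomial.X : Polynomial ℝ))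
      ((Polynomial.aeval t : Polynomial ℝ →ₐ[ℝ] ℝ).restrictScalars ℚ) q
    simp only [AlgHom.restrictScalars_apply, Polynomial.aeval_X,
      Polynomial.coe_aeval_eq_eval] at h
    rw [hP, h]
  set Pt := Polynomial.taylor x₀ P with hPt
  refine ⟨Pt.natDegree + 1, fun m => Pt.coeff m, fun u => ?_⟩
  rw [← hev, show x₀ + u = u + x₀ from add_comm _ _, ← Polynomial.taylor_eval,
    Polynomial.eval_eq_sum_range]

/-- At the abscissa `x₀`, the wall block `∏ⱼ (κⱼ x + μⱼ)^{eⱼ}` factors as `u^E · W₁(u)`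
(`x = x₀ + u`) with `W₁` polynomial and `W₁(0) ≠ 0`, provided the walls vanishing at `x₀` have
`κⱼ ≠ 0`. -/
theorem wall_factor {m : ℕ} (κ μ : Fin m → ℝ) (e : Fin m → ℕ) (x₀ : ℝ)
    (hκ : ∀ j, κ j * x₀ + μ j = 0 → e j ≠ 0 → κ j ≠ 0) :
    ∃ (E : ℕ) (W₁ : ℝ → ℝ), Continuous W₁ ∧ W₁ 0 ≠ 0 ∧
      (E ≠ 0 → ∃ j, κ j * x₀ + μ j = 0 ∧ e j ≠ 0) ∧
      ∀ u : ℝ, ∏ j, (κ j * (x₀ + u) + μ j) ^ e j = u ^ E * W₁ u := by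
  classical
  set V := Finset.univ.filter fun j => κ j * x₀ + μ j = 0 with hV
  refine ⟨∑ j ∈ V, e j, fun u => (∏ j ∈ V, κ j ^ e j) *
    ∏ j ∈ Finset.univ.filter (fun j => ¬ κ j * x₀ + μ j = 0), (κ j * (x₀ + u) + μ j) ^ e j,
    by fun_prop, ?_, ?_, fun u => ?_⟩
  · refine mul_ne_zero (Finset.prod_ne_zero_iff.2 fun j hj => ?_)
      (Finset.prod_ne_zero_iff.2 fun j hj => ?_)
    · by_cases he : e j = 0
      · simp [he]
      · exact pow_ne_zero _ (hκ j (Finset.mem_filter.1 hj).2 he)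
    · have h := (Finset.mem_filter.1 hj).2
      rw [add_zero]; exact pow_ne_zero _ h
  · intro hE
    obtain ⟨j, hj, he⟩ := Finset.exists_ne_zero_of_sum_ne_zero hE
    exact ⟨j, (Finset.mem_filter.1 hj).2, he⟩
  · rw [← Finset.prod_filter_mul_prod_filter_not Finset.univ (fun j => κ j * x₀ + μ j = 0),
      ← mul_assoc]
    congr 1
    rw [mul_comm, ← Finset.prod_pow_eq_pow_sum, ← Finset.prod_mul_distrib]
    refine Finset.prod_congr rfl fun j hj => ?_
    have h := (Finset.mem_filter.1 hj).2
    rw [← mul_pow, show κ j * (x₀ + u) + μ j = κ j * u + (κ j * x₀ + μ j) by ring, h, add_zero]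

open SeparatePos

/-- The base index `x` of `Fin (1 + 1 + 0)`. -/
theorem cA0 : (Fin.castAdd 0 (Fin.castSucc (0 : Fin 1)) : Fin (1 + 1 + 0)) = 0 := rfl

/-- The base index `y` of `Fin (1 + 1 + 0)`. -/
theorem cA1 : (Fin.castAdd 0 (Fin.last 1) : Fin (1 + 1 + 0)) = 1 := rfl

/-- An `x`-form in coordinates. -/
theorem affB_eq (c : (Fin 1 → ℚ) × ℚ) (z : Fin (1 + 1 + 0) → ℝ) :
    affB 1 0 c z = (c.1 0 : ℝ) * z 0 + c.2 := by
  simp [affB]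

/-- A full-base form in coordinates. -/
theorem rowval_eq (c : (Fin (1 + 1) → ℚ) × ℚ) (z : Fin (1 + 1 + 0) → ℝ) :
    ∑ i, (c.1 i : ℝ) * z (Fin.castAdd 0 i) + c.2 = c.1 0 * z 0 + c.1 1 * z 1 + c.2 := by
  simp [Fin.sum_univ_two]

/-- Without fibres the fibre block is `1`. -/
theorem fib_zero (a : Fin 0 → Option ((Fin (1 + 1) → ℚ) × ℚ)) (z : Fin (1 + 1 + 0) → ℝ) :
    fib 1 0 a z = 1 := by
  simp [fib]

/-- The `x`-part of a point. -/
theorem xpart_eq (z : Fin (1 + 1 + 0) → ℝ) :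
    (fun i : Fin 1 => z (Fin.castAdd 0 (Fin.castSucc i))) = fun _ => z 0 := by
  funext i; fin_cases i; rfl

/-- The chart in the coordinates of `Fin (1+1+0) → ℝ`. -/
theorem chart_coord (x₀ sl ic : ℝ) (w : ℝ × ℝ) :
    (chart x₀ sl ic w : Fin (1 + 1 + 0) → ℝ) 0 = x₀ + w.1 ∧
      (chart x₀ sl ic w : Fin (1 + 1 + 0) → ℝ) 1 = w.2 + (sl * (x₀ + w.1) + ic) :=
  ⟨chart_apply_zero x₀ sl ic w, chart_apply_one x₀ sl ic w⟩

/-- Inequalities between continuous functions pass to the closure. -/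
theorem le_of_mem_closure' {X : Type*} [TopologicalSpace X] {t : Set X} {f g : X → ℝ}
    (hf : Continuous f) (hg : Continuous g) (h : ∀ z ∈ t, f z ≤ g z) {z : X}
    (hz : z ∈ closure t) : f z ≤ g z :=
  closure_minimal (fun z hz => show z ∈ {z | f z ≤ g z} from h z hz) (isClosed_le hf hg) hz

/-- Uniform real Taylor data for the coefficients `qᵢ`, `i < N`, at the abscissa `x₀`. -/
theorem exists_coeff_data (N : ℕ) (q : ℕ → MvPolynomial (Fin 1) ℚ) (x₀ : ℝ) :
    ∃ (N' : ℕ) (cc : ℕ × ℕ → ℝ) (Q : ℕ → ℝ → ℝ),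
      (∀ i u, Q i u = ∑ m ∈ Finset.range N', cc (i, m) * u ^ m) ∧
      (∀ i < N, ∀ u, Q i u = MvPolynomial.aeval (fun _ : Fin 1 => x₀ + u) (q i)) := by
  choose K c hc using fun i => exists_real_taylor (q i) x₀
  refine ⟨(Finset.range N).sup K, fun im => if im.1 < N ∧ im.2 < K im.1 then c im.1 im.2 else 0,
    fun i u => if i < N then MvPolynomial.aeval (fun _ : Fin 1 => x₀ + u) (q i) else 0,
    fun i u => ?_, fun i hi u => by simp [hi]⟩
  by_cases hi : i < N
  · simp only [hi, if_true, true_and, hc]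
    rw [SeparatePos.sum_range_extend (fun m => (if m < K i then c i m else 0) * u ^ m)
      (Finset.le_sup (f := K) (Finset.mem_range.2 hi)) (fun m hm => by simp [not_lt.2 hm])]
    exact Finset.sum_congr rfl fun m hm => by rw [if_pos (Finset.mem_range.1 hm)]
  · simp [hi]

end SepTwoZero

open SepTwoZero in
/-- **The shear chart preserves area** (registered sub-goal of `stub_separateTwoZero`). -/
theorem separateTwoZero_chart (x₀ sl ic : ℝ) : MeasureTheory.MeasurePreserving (fun w : ℝ × ℝ => (![x₀ + w.1, w.2 + (sl * (x₀ + w.1) + ic)] : Fin 2 → ℝ)) MeasureTheory.volume MeasureTheory.volume := by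
  have h : (fun w : ℝ × ℝ => (![x₀ + w.1, w.2 + (sl * (x₀ + w.1) + ic)] : Fin 2 → ℝ)) =
      fun w => chart x₀ sl ic w := funext fun w => (chart_apply x₀ sl ic w).symm
  rw [h]; exact measurePreserving_chart x₀ sl ic

end Summit.KontsevichZagierPeriods.ArrangementNormalForm.JanusBands
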